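/-
Copyright: the b2b-balaban T⁴-continuum CRUX team, row NE7b OWNER lineage `t4-ne7b-p1` (gen 146). Project licence.
-/
import Summits.QuantumFields.BalabanUV.T4Continuum.Spine.NE7b.SupWeightedFivePointToolsTwo

/-!
# SCALAR TOOLS FOR THE WEIGHTED FIVE-POINT SLOT LETTERS, III (SCOPING-d17 §F, F13–F17): the `U‴`-triple's geometry sum when the
# triple's hub carries the legs.  (691)'s `pmono` drops the pair edge `(b,c)` of the triple `{A,b,c}` (load `≤ 2`) and keeps the two
# anchor edges (loads `≤ 4`).  When the legs of the term hang off a NON-anchor vertex of the triple, that vertex's edges carry load `3` and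
# the light edge is an ANCHOR edge; these variants drop the first ∕ second anchor edge instead and sum the remaining product with one
# Fubini swap (row NE7b, node U5c; Mathlib ∕ (691) only; [folklore]).

Cell `pub-balaban`, sub-cell `t4`, spine estimate NE7b (`T4WeightBudget.RelWeightBound`; the cell's OWN estimate — NOT PRINTED in
[Bałaban 1983–89], NOT PROVED).  Crux-route work under `Spine/NE7b/` by the row OWNER (`t4-ne7b-p1` gen 146, file (700)) under FREEZE
(0)'s crux-prover clause; NOTHING of Bałaban's is named as a Lean object, valued or asserted; no `T4Continuum/Support` leaf typed; no
`def`, no notation; zero `sorry`.  Imports (BY NAME): the OWNER's (691) `…SupWeightedFivePointToolsTwo`.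

WHAT IS PROVED ([folklore]): `pmono_first`, `pmono_second`, `geom_first`, `geom_second`; toy.

HONEST (what this is NOT).  Abstract inequalities only; scalar skeleton ((A3), NC-NE7b-α UNRULED); nothing of Bałaban's asserted.  BY-NAME
EFFECT ON THE WALL: NONE.  NE7b NOT PRINTED ∕ NOT PROVED; spine PROVED 0∕9; rung (B)+1 — the programme's measures remain FINITE-torus
statements; NOT the mass gap, NOT Clay.  HONEST DEPENDENCY: continuum YM on T⁴ ⇐ BetaPertH ∧ nine spine estimates (0∕9 proved); BetaPertH ⇐
(D1) ∧ (D4) ∧ CAP+tail; G-an2-4 gates asym, D1 and NE2∕3∕4.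
-/

set_option autoImplicit false

noncomputable section

namespace Summit.QuantumFields.BalabanUV.T4Continuum.NE7b.SupWeightedFivePointToolsThree

open Finset Real
open scoped BigOperators
open SupWeightedFivePointToolsTwo (tmono)

/-- Drop the FIRST anchor edge: `(a^i b^j c^k)²∕(θ₁θ₂θ₃) ≤ (b⁴)²∕θ₂ · (c⁴)²∕θ₃` when `(a^i)² ≤ θ₁`, `j, k ≤ 4`. [folklore] -/
theorem pmono_first {a b c θ₁ θ₂ θ₃ : ℝ} {i j k : ℕ} (ha : 1 ≤ a) (hb : 1 ≤ b) (hc : 1 ≤ c) (h₁ : 0 < θ₁) (h₂ : 0 < θ₂) (h₃ : 0 < θ₃)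
    (hai : (a ^ i) ^ 2 ≤ θ₁) (hj : j ≤ 4) (hk : k ≤ 4) :
    (a ^ i * b ^ j * c ^ k) ^ 2 / (θ₁ * θ₂ * θ₃) ≤ (b ^ 4) ^ 2 / θ₂ * ((c ^ 4) ^ 2 / θ₃) := by
  have ha0 : 0 ≤ a := zero_le_one.trans ha
  have hq : (a ^ i) ^ 2 / θ₁ ≤ 1 := (div_le_one h₁).2 hai
  calc (a ^ i * b ^ j * c ^ k) ^ 2 / (θ₁ * θ₂ * θ₃) = (a ^ i) ^ 2 / θ₁ * ((b ^ j) ^ 2 / θ₂ * ((c ^ k) ^ 2 / θ₃)) := by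
        rw [mul_pow, mul_pow]; field_simp
    _ ≤ 1 * ((b ^ 4) ^ 2 / θ₂ * ((c ^ 4) ^ 2 / θ₃)) :=
        mul_le_mul hq (mul_le_mul (tmono hb h₂ hj) (tmono hc h₃ hk) (by positivity) (by positivity)) (by positivity) zero_le_one
    _ = (b ^ 4) ^ 2 / θ₂ * ((c ^ 4) ^ 2 / θ₃) := one_mul _

/-- Drop the SECOND anchor edge: `(a^i b^j c^k)²∕(θ₁θ₂θ₃) ≤ (a⁴)²∕θ₁ · (c⁴)²∕θ₃` when `(b^j)² ≤ θ₂`, `i, k ≤ 4`. [folklore] -/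
theorem pmono_second {a b c θ₁ θ₂ θ₃ : ℝ} {i j k : ℕ} (ha : 1 ≤ a) (hb : 1 ≤ b) (hc : 1 ≤ c) (h₁ : 0 < θ₁) (h₂ : 0 < θ₂) (h₃ : 0 < θ₃)
    (hbj : (b ^ j) ^ 2 ≤ θ₂) (hi : i ≤ 4) (hk : k ≤ 4) :
    (a ^ i * b ^ j * c ^ k) ^ 2 / (θ₁ * θ₂ * θ₃) ≤ (a ^ 4) ^ 2 / θ₁ * ((c ^ 4) ^ 2 / θ₃) := by
  have hb0 : 0 ≤ b := zero_le_one.trans hb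
  have hq : (b ^ j) ^ 2 / θ₂ ≤ 1 := (div_le_one h₂).2 hbj
  calc (a ^ i * b ^ j * c ^ k) ^ 2 / (θ₁ * θ₂ * θ₃) = (b ^ j) ^ 2 / θ₂ * ((a ^ i) ^ 2 / θ₁ * ((c ^ k) ^ 2 / θ₃)) := by
        rw [mul_pow, mul_pow]; field_simp
    _ ≤ 1 * ((a ^ 4) ^ 2 / θ₁ * ((c ^ 4) ^ 2 / θ₃)) :=
        mul_le_mul hq (mul_le_mul (tmono ha h₁ hi) (tmono hc h₃ hk) (by positivity) (by positivity)) (by positivity) zero_le_one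
    _ = (a ^ 4) ^ 2 / θ₁ * ((c ^ 4) ^ 2 / θ₃) := one_mul _

variable {ι : Type} [Fintype ι]

/-- After dropping the first anchor edge: `Σ_bΣ_c g_c·h_{bc} ≤ T·T'` when `Σ_c g ≤ T`, `Σ_b h_{bc} ≤ T'` for every `c` (one Fubini swap).
[folklore] -/
theorem geom_first {g : ι → ℝ} {h : ι → ι → ℝ} {T T' : ℝ} (hg0 : ∀ c, 0 ≤ g c) (hh : ∀ c, ∑ b, h b c ≤ T') (hG : ∑ c, g c ≤ T)
    (hT' : 0 ≤ T') : ∑ b, ∑ c, g c * h b c ≤ T * T' := by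
  rw [Finset.sum_comm]
  calc ∑ c, ∑ b, g c * h b c = ∑ c, g c * ∑ b, h b c := by simp only [mul_sum]
    _ ≤ ∑ c, g c * T' := sum_le_sum fun c _ => mul_le_mul_of_nonneg_left (hh c) (hg0 c)
    _ = (∑ c, g c) * T' := by rw [sum_mul]
    _ ≤ T * T' := mul_le_mul_of_nonneg_right hG hT'

/-- After dropping the second anchor edge: `Σ_bΣ_c f_b·h_{bc} ≤ T·T'` when `Σ_b f ≤ T`, `Σ_c h_{bc} ≤ T'` for every `b`. [folklore] -/
theorem geom_second {f : ι → ℝ} {h : ι → ι → ℝ} {T T' : ℝ} (hf0 : ∀ b, 0 ≤ f b) (hh : ∀ b, ∑ c, h b c ≤ T') (hF : ∑ b, f b ≤ T)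
    (hT' : 0 ≤ T') : ∑ b, ∑ c, f b * h b c ≤ T * T' := by
  calc ∑ b, ∑ c, f b * h b c = ∑ b, f b * ∑ c, h b c := by simp only [mul_sum]
    _ ≤ ∑ b, f b * T' := sum_le_sum fun b _ => mul_le_mul_of_nonneg_left (hh b) (hf0 b)
    _ = (∑ b, f b) * T' := by rw [sum_mul]
    _ ≤ T * T' := mul_le_mul_of_nonneg_right hF hT'

/-! ## Toy -/

/-- Toy (the swap in numbers, one point): `g·h ≤ T·T'` for `0 ≤ g ≤ T`, `h ≤ T'`, `0 ≤ T'`. -/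
example (g h T T' : ℝ) (hg : 0 ≤ g) (h1 : g ≤ T) (h2 : h ≤ T') (hT : 0 ≤ T') : g * h ≤ T * T' := by nlinarith

end Summit.QuantumFields.BalabanUV.T4Continuum.NE7b.SupWeightedFivePointToolsThree

end
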